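import Summits.BirchSwinnertonDyer.BirchSwinnertonDyer.Theorems.KolyvaginDepthDoorDepthTableKuriharaExact997c1
import Summits.BirchSwinnertonDyer.BirchSwinnertonDyer.Theorems.KolyvaginDepthDoorDepthTableKuriharaDecisivePrime
import Summits.BirchSwinnertonDyer.Rank1Residual.Supersingular.CountPointsFast
import HarnessLib

/-!
# Route `KolyvaginDepthDoor`, crux `KolyvaginDepthSupplyKN` (stmt-BirchSwinnertonDyer-22820) —
# DEPTH TABLE v21, ROW `997c1` @ `(7, d_K = −23)`: the SECOND decisive prime `617` (kernel: `90 • P̄ ≠ O` in `T̃₀(𝔽_617)`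
# for the tree's twist point `P = (116922/289, 38145975/4913)`, `#T̃₀(𝔽_617) = 630 = 7·90`) and the AGREEMENT test `unit_239_iff_unit_617`

Helper file of the lead prover of line `levelone` (kdd-p1 g25; `--supports stmt-BirchSwinnertonDyer-22820
--as helper`); it closes nothing and BSD is NOT proved by it. Same template as `…KuriharaDecisive794a1B` / `…Decisive709a1B`.

With `rank E(ℚ) = 2` for `997c1` a kernel theorem (v21, `…KernelRankTwo997`) the row at `(7, −23)` reads exactly
(`…KuriharaExact997c1`: bit ⟺ unit `δ̃_239(T₀)`). This file gives the row its SECOND cyclic Kolyvagin prime, as the twelve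
older exact rows have: `617` (`617 ≡ 1`, `a_617(T₀) = -12 ≡ 2 (mod 7)`, `#T̃₀(𝔽_617) = 630 = 7·90`, `7² ∤ 630`), at which the
tree's twist point `P` (`C997c1.minTwist23_nonsingular_P`, g24; denominators prime to `617`) reduces to `P̄ = (174, 29)` with
`90 • P̄ = (14, 16) ≠ O` — a 9-step double-and-add chain checked by `decide` on `Rank2Observatory.chainB` —, so
`P ∉ 7·T₀(ℚ_617)` (`localNondivisible_of_chainB_rat`). HENCE (Sakamoto 2022 L4.4 + L4.6 (1) BY NAME, `hSak3`):

* `twistKuriharaClaim_617_of_natCard_selmerGroup_le` — `#Sel₇(E^{(−23)}) ≤ 7 ⟹` unit `δ̃_617(T₀)` for every admissible datum;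
* `twistKuriharaBit_iff_unit_617` — **bit ⟺ unit at `617`** (⟹ via `exactRowZhang_7_neg23_rankFree`; ⟸ via the socket iff);
* `unit_239_iff_unit_617` — the AGREEMENT test: two decisive residues that disagree contradict the print facts named
  (DECISIVE-RESIDUES-v20 computed both as units).

CONDITIONAL on the named facts displayed and the E-side record claim `hδE` (`cert_997c1` @ `(7, 43·239)`); per curve; nothing
class-wide; BSD is NOT proved by any of this.

References: [Sakamoto2022pSelmer] Lemma 4.4, Lemma 4.6 (1), Thm. 1.2, Thm. 1.5; [Kim2022StructureSelmer] Thm. 1.11, §1.2.2;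
[WZhang2014] Lemma 8.4 (1), Thm. 9.1; [GrossLMS1991] Prop. 3.7 (2); [SilvermanAEC2009] III.2.3, VII.2.1, VII.3.1, X.5 Cor. 5.4;
[CremonaAlgorithms1997] Table 1 (997c1).
-/

set_option linter.dupNamespace false

noncomputable section

open scoped Classical NumberField

namespace Summit.BirchSwinnertonDyer.BirchSwinnertonDyer.Theorems.KolyvaginDepthDoor

open Literature.NumberTheory.EllipticCurves Literature.NumberTheory.EllipticCurves.ModularForms
  WeierstrassCurve NumberField IsDedekindDomain
open Summit.BirchSwinnertonDyer.BirchSwinnertonDyer.Theorems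
open Summit.BirchSwinnertonDyer.BirchSwinnertonDyer.Rank2Observatory
open Summit.BirchSwinnertonDyer.BirchSwinnertonDyer.Rank1Residual (IntModel.frobeniusTrace_eq)
open Summit.BirchSwinnertonDyer.Rank1Residual.Supersingular (natCard_point_eq_of_countPoints countPoints_eq_of_fast)
open Summit.BirchSwinnertonDyer.Rank1Residual.Additive (card_torsion_le_of_intModel_of_card
  isKolyvaginPrime_of_intModel_of_card)

namespace C997c1

/-! ## §1 Kernel: `617` is a cyclic Kolyvagin prime of `(T₀, 7)` at which the tree's twist point is locally `7`-indivisible -/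

/-- `#T̃₀(𝔽_617) = 630 = 7·90` for `T₀ = [0, -1, 1, -12872, -557532]` (`617 ≡ 1 (mod 7)`, `a_617(T₀) = -12 ≡ 2 (mod 7)`, `7² ∤ 630`),
kernel-decided (`countPointsFast`). [cite: Kim2022StructureSelmer, §1.2.2 (PDF p. 5)] -/
theorem minTwist23_card_617 :
    Nat.card (((⟨0, -1, 1, -12872, -557532⟩ : WeierstrassCurve ℤ).map (Int.castRingHom (ZMod 617))).toAffine.Point) = 630 :=
  haveI : Fact (Nat.Prime 617) := ⟨by norm_num⟩
  natCard_point_eq_of_countPoints 0 (-1) 1 (-12872) (-557532) 617 (by norm_num) (by decide +kernel) (n := 630)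
    (countPoints_eq_of_fast (by decide +kernel))

/-- **`617` is a CYCLIC KOLYVAGIN PRIME for `(T₀, 7)`** (`617 ∤ 7·N_{T₀}`, `617 ≡ 1`, `a_617(T₀) ≡ 2 (mod 7)`, `#T̃₀(𝔽_617)[7] ≤ 7`).
[cite: Kim2022StructureSelmer, §1.2.2 (PDF p. 5)] -/
theorem minTwist23_isCyclicKolyvaginLevel_7_617 :
    haveI := minTwist23_isGloballyMinimal; haveI := Fact.mk (by norm_num : Nat.Prime 7);
    IsCyclicKolyvaginLevel ((⟨0, -1, 1, -12872, -557532⟩ : WeierstrassCurve ℤ).map (Int.castRingHom ℚ)) 7 617 := by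
  haveI := minTwist23_isElliptic
  haveI := minTwist23_isGloballyMinimal
  haveI := Fact.mk (by norm_num : Nat.Prime 7)
  haveI : Fact (Nat.Prime 617) := ⟨by norm_num⟩
  have hℓ : Kato.IsKolyvaginPrime ((⟨0, -1, 1, -12872, -557532⟩ : WeierstrassCurve ℤ).map (Int.castRingHom ℚ)) 7 1 617 :=
    isKolyvaginPrime_of_intModel_of_card minTwist23_intModel 7 1 617 (by norm_num) (by decide +kernel) (by decide)
      minTwist23_card_617 (by norm_num)
  refine ⟨⟨Nat.squarefree_iff_nodup_primeFactorsList (by norm_num) |>.mpr (by simp), fun ℓ hℓ' ↦ ?_⟩, fun ℓ hℓ' hdvd ↦ ?_⟩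
  · rw [show (617 : ℕ).primeFactors = {617} from (Nat.Prime.primeFactors (by norm_num)), Finset.mem_singleton] at hℓ'
    exact hℓ' ▸ hℓ
  · obtain rfl := (Nat.prime_dvd_prime_iff_eq hℓ'.out (by norm_num)).mp hdvd
    exact card_torsion_le_of_intModel_of_card minTwist23_intModel 7 617 minTwist23_card_617 (by norm_num)

/-- The double-and-add chain from `P̄` reaches the multiplier `90`. [folklore] -/
theorem chain617_mult :
    chainMult 1 [(true, (172 : ZMod 617), (572 : ZMod 617)), (true, (402 : ZMod 617), (215 : ZMod 617)), (false, (596 : ZMod 617), (535 : ZMod 617)), (true, (394 : ZMod 617), (101 : ZMod 617)), (false, (168 : ZMod 617), (488 : ZMod 617)), (true, (424 : ZMod 617), (575 : ZMod 617)), (true, (613 : ZMod 617), (366 : ZMod 617)), (false, (252 : ZMod 617), (187 : ZMod 617)), (true, (14 : ZMod 617), (16 : ZMod 617))] = 90 := by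
  decide

/-- The double-and-add chain from `P̄ = (174, 29)` to `90 • P̄ = (14, 16)` in `T̃₀(𝔽_617)` CHECKS (tangent / chord certificates,
`decide`). [cite: SilvermanAEC2009, III.2.3] -/
theorem chain617_ok :
    chainB (⟨0, -1, 1, -12872, -557532⟩ : WeierstrassCurve ℤ) 617 (((174 : ℤ)) : ZMod 617) (((29 : ℤ)) : ZMod 617)
      ((((174 : ℤ)) : ZMod 617), (((29 : ℤ)) : ZMod 617))
      [(true, (172 : ZMod 617), (572 : ZMod 617)), (true, (402 : ZMod 617), (215 : ZMod 617)), (false, (596 : ZMod 617), (535 : ZMod 617)), (true, (394 : ZMod 617), (101 : ZMod 617)), (false, (168 : ZMod 617), (488 : ZMod 617)), (true, (424 : ZMod 617), (575 : ZMod 617)), (true, (613 : ZMod 617), (366 : ZMod 617)), (false, (252 : ZMod 617), (187 : ZMod 617)), (true, (14 : ZMod 617), (16 : ZMod 617))] = true := by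
  decide +kernel

/-- **KERNEL: `P = (116922/289, 38145975/4913)` is not divisible by `7` in `T₀(ℚ_617)`** — the chain certifies `90 • P̄ ≠ O` in
`T̃₀(𝔽_617)` for the reduction `P̄ = (174, 29)`, `7·90 = #T̃₀(𝔽_617)`, and `localNondivisible_of_chainB_rat`.
[cite: SilvermanAEC2009, III.2.3, VII.2 Prop. 2.1, VII.3 Prop. 3.1] -/
theorem minTwist23_localNondivisible_617 :
    haveI : Fact (Nat.Prime 617) := ⟨by norm_num⟩;
    ∀ Q : ((((⟨0, -1, 1, -12872, -557532⟩ : WeierstrassCurve ℤ).map (Int.castRingHom ℚ))).baseChange ℚ_[617]).toAffine.Point,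
      7 • Q ≠ WeierstrassCurve.Affine.Point.map (W' := (((⟨0, -1, 1, -12872, -557532⟩ : WeierstrassCurve ℤ).map (Int.castRingHom ℚ))).toAffine)
        (S := ℚ) (Algebra.ofId ℚ ℚ_[617]) (.some ((116922 : ℚ) / 289) ((38145975 : ℚ) / 4913) minTwist23_nonsingular_P) := by
  haveI : Fact (Nat.Prime 617) := ⟨by norm_num⟩
  have hq : ¬ ((617 : ℕ) : ℤ) ∣ (⟨0, -1, 1, -12872, -557532⟩ : WeierstrassCurve ℤ).Δ := by decide +kernel
  have hx : ¬ (617 : ℕ) ∣ (((116922 : ℚ) / 289)).den := by decide +kernel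
  have hy : ¬ (617 : ℕ) ∣ (((38145975 : ℚ) / 4913)).den := by decide +kernel
  have hm : ((617 : ℕ) : ℤ) ∣ (((116922 : ℚ) / 289)).num - (174 : ℤ) * (((116922 : ℚ) / 289)).den := by decide +kernel
  have hm' : ((617 : ℕ) : ℤ) ∣ (((38145975 : ℚ) / 4913)).num - (29 : ℤ) * (((38145975 : ℚ) / 4913)).den := by decide +kernel
  have hpk : 7 * 90 = Nat.card (((⟨0, -1, 1, -12872, -557532⟩ : WeierstrassCurve ℤ).map (Int.castRingHom (ZMod 617))).toAffine.Point) := by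
    rw [minTwist23_card_617]
  exact localNondivisible_of_chainB_rat (⟨0, -1, 1, -12872, -557532⟩ : WeierstrassCurve ℤ) 617 hq minTwist23_nonsingular_P hx hy hm hm' hpk
    chain617_mult (by convert chain617_ok)

/-! ## §2 The second decisive prime `617`: Selmer-bound form, bit ⟺ unit, agreement with `239` -/

/-- **ROW `997c1` @ `(7, −23)`: THE SECOND DECISIVE PRIME `617`, Selmer-bound form.** For every imaginary quadratic `K` with
`d_K = −23`, granted `hSak3` (Sakamoto 2022 L4.4 + L4.6 (1) by name): IF `#Sel₇(E^{(d_K)}/ℚ) ≤ 7`, THEN every datum `D` of `T₀`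
at level `N_{T₀}` with `7 ∤ c_D` and the period transfer has a UNIT mod-`7` Kurihara number AT `617`. Side conditions all kernel.
CONDITIONAL on `hSak3`; per curve; BSD is not proved by it. [cite: Sakamoto2022pSelmer, Lemma 4.4, Lemma 4.6 (1)]
[cite: SilvermanAEC2009, X.5 Cor. 5.4] [cite: CremonaAlgorithms1997, Table 1 (997c1)] -/
theorem twistKuriharaClaim_617_of_natCard_selmerGroup_le
    (hSak3 : Literature.NumberTheory.EllipticCurves.Sakamoto2022_kuriharaNumber_prime_ne_zero_of_localNondivisible)
    (K : Type) [Field K] [NumberField K] (hD : NumberField.discr K = -23)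
    (hle : haveI := isElliptic_c997c1; haveI := isGloballyMinimal_c997c1; haveI := Fact.mk (by norm_num : Nat.Prime 7);
      Nat.card ((((⟨0, -1, 1, -24, 54⟩ : WeierstrassCurve ℤ).map (Int.castRingHom ℚ)).quadraticTwist (NumberField.discr K : ℚ)).selmerGroup (7 : ℕ)) ≤ 7) :
    haveI := minTwist23_isElliptic; haveI := minTwist23_isGloballyMinimal;
    haveI : NeZero (((⟨0, -1, 1, -12872, -557532⟩ : WeierstrassCurve ℤ).map (Int.castRingHom ℚ)).conductorNorm ℤ) := neZero_conductorNorm_of_isElliptic _;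
    haveI := Fact.mk (by norm_num : Nat.Prime 7);
    ∀ (D : ModularParametrizationData ((⟨0, -1, 1, -12872, -557532⟩ : WeierstrassCurve ℤ).map (Int.castRingHom ℚ))
          (((⟨0, -1, 1, -12872, -557532⟩ : WeierstrassCurve ℤ).map (Int.castRingHom ℚ)).conductorNorm ℤ)),
        ¬ ((7 : ℕ) : ℤ) ∣ D.maninConstant →
        (∃ u : ℚ, ‖(u : ℚ_[7])‖ = 1 ∧
          ((⟨0, -1, 1, -12872, -557532⟩ : WeierstrassCurve ℤ).map (Int.castRingHom ℚ)).realPeriodRat = u * plusPeriod D.f) →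
        ∃ ψ : (q : ℕ) → (ZMod q)ˣ →* Multiplicative (ZMod 7),
          (∀ q ∈ (617 : ℕ).primeFactors, Function.Surjective (ψ q)) ∧ kuriharaNumber D.f 7 617 ψ ≠ 0 := by
  haveI := isElliptic_c997c1
  haveI := isGloballyMinimal_c997c1
  haveI := minTwist23_isElliptic
  haveI := minTwist23_isGloballyMinimal
  haveI iNZT : NeZero (((⟨0, -1, 1, -12872, -557532⟩ : WeierstrassCurve ℤ).map (Int.castRingHom ℚ)).conductorNorm ℤ) :=
    neZero_conductorNorm_of_isElliptic _
  haveI iP := Fact.mk (by norm_num : Nat.Prime 7)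
  haveI : Fact (Nat.Prime 617) := ⟨by norm_num⟩
  have hsur : ((⟨0, -1, 1, -24, 54⟩ : WeierstrassCurve ℤ).map (Int.castRingHom ℚ)).HasSurjectiveModNGaloisRep ((7 : ℕ) : ℤ) := by
    simpa using hasSurjectiveModNGaloisRep_7
  have hC : (⟨1, (8 : ℚ), (0 : ℚ), -((1 : ℚ) / 2)⟩ : WeierstrassCurve.VariableChange ℚ) •
      ((⟨0, -1, 1, -12872, -557532⟩ : WeierstrassCurve ℤ).map (Int.castRingHom ℚ)) =
      ((⟨0, -1, 1, -24, 54⟩ : WeierstrassCurve ℤ).map (Int.castRingHom ℚ)).quadraticTwist ((NumberField.discr K : ℤ) : ℚ) := by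
    rw [hD]; push_cast; exact minTwist23_smul_eq
  have hpD : ¬ (((7 : ℕ) : ℤ) ∣ NumberField.discr K) := by rw [hD]; decide
  intro D hc hu
  exact twistKuriharaClaim_prime_of_natCard_selmerGroup_le hSak3 _ 7 (by norm_num) goodOrdinary_7.1 goodOrdinary_7.2 hsur
    (NumberField.discr_ne_zero K) hpD _ _ hC minTwist23_nonAnomalous_7 minTwist23_kodairaNeron_7 hle 617
    minTwist23_isCyclicKolyvaginLevel_7_617 _ minTwist23_localNondivisible_617 D hc hu

/-- **ROW `997c1` @ `(7, −23)`: the SECOND prime `617` — bit ⟺ unit `δ̃_617(T₀)`.** For every imaginary quadratic `K` with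
`d_K = −23`, granted the eight named facts and the E-side claim `hδE`: the depth-table bit holds IFF every admissible datum of `T₀`
has a unit mod-`7` Kurihara number AT `617`. (⟹) `exactRowZhang_7_neg23_rankFree` + `twistKuriharaClaim_617_of_natCard_selmerGroup_le`;
(⟸) `kolyvaginPrime_iff_twistKuriharaBit_7_neg23` with `m = 617`. CONDITIONAL; per curve; BSD is not proved by it.
[cite: Sakamoto2022pSelmer, Lemma 4.4, Lemma 4.6 (1), Thm. 1.2, Thm. 1.5] [cite: Kim2022StructureSelmer, Thm. 1.11]
[cite: WZhang2014, Lemma 8.4 (1) (p. 236)] [cite: GrossLMS1991, Prop. 3.7 (2)] [cite: CremonaAlgorithms1997, Table 1 (997c1)] -/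
theorem twistKuriharaBit_iff_unit_617
    (h372 : GrossLMS1991.prop37_2_frobeniusCongruence)
    (h84 : Literature.NumberTheory.EllipticCurves.WZhang2014_lemma84_exists_minimal_kolyvaginClass_one_selmerCard)
    (hKim : Kim2022_card_selmerGroup_le_pow_of_kuriharaNumber_ne_zero)
    (hSak1 : Sakamoto2022_card_selmerGroup_eq_pow_of_isDeltaMinimal)
    (hSak2 : Sakamoto2022_exists_cyclicLevel_kuriharaNumber_ne_zero)
    (hSak3 : Literature.NumberTheory.EllipticCurves.Sakamoto2022_kuriharaNumber_prime_ne_zero_of_localNondivisible)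
    (hnf : exists_isNewformOf) (hMaz : mazur_not_dvd_maninConstant_of_odd)
    (K : Type) [Field K] [NumberField K] (hK : IsImaginaryQuadratic K) (hD : NumberField.discr K = -23)
    (hδE : haveI := isElliptic_c997c1; haveI := isGloballyMinimal_c997c1;
      haveI : NeZero (((⟨0, -1, 1, -24, 54⟩ : WeierstrassCurve ℤ).map (Int.castRingHom ℚ)).conductorNorm ℤ) := neZero_conductorNorm_of_isElliptic _;
      haveI := Fact.mk (by norm_num : Nat.Prime 7);
      ∀ (D : ModularParametrizationData ((⟨0, -1, 1, -24, 54⟩ : WeierstrassCurve ℤ).map (Int.castRingHom ℚ)) (((⟨0, -1, 1, -24, 54⟩ : WeierstrassCurve ℤ).map (Int.castRingHom ℚ)).conductorNorm ℤ)), ¬ ((7 : ℕ) : ℤ) ∣ D.maninConstant →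
        (∃ u : ℚ, ‖(u : ℚ_[7])‖ = 1 ∧ ((⟨0, -1, 1, -24, 54⟩ : WeierstrassCurve ℤ).map (Int.castRingHom ℚ)).realPeriodRat = u * plusPeriod D.f) →
        ∃ ψ : (ℓ : ℕ) → (ZMod ℓ)ˣ →* Multiplicative (ZMod 7),
          (∀ ℓ ∈ (10277 : ℕ).primeFactors, Function.Surjective (ψ ℓ)) ∧ kuriharaNumber D.f 7 10277 ψ ≠ 0) :
    haveI := isElliptic_c997c1; haveI := isGloballyMinimal_c997c1;
      haveI : NeZero (((⟨0, -1, 1, -24, 54⟩ : WeierstrassCurve ℤ).map (Int.castRingHom ℚ)).conductorNorm ℤ) := neZero_conductorNorm_of_isElliptic _;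
      haveI := Fact.mk (by norm_num : Nat.Prime 7);
    haveI := minTwist23_isElliptic; haveI := minTwist23_isGloballyMinimal;
    haveI : NeZero (((⟨0, -1, 1, -12872, -557532⟩ : WeierstrassCurve ℤ).map (Int.castRingHom ℚ)).conductorNorm ℤ) := neZero_conductorNorm_of_isElliptic _;
    (∃ (Dt : ModularParametrizationData ((⟨0, -1, 1, -24, 54⟩ : WeierstrassCurve ℤ).map (Int.castRingHom ℚ)) (((⟨0, -1, 1, -24, 54⟩ : WeierstrassCurve ℤ).map (Int.castRingHom ℚ)).conductorNorm ℤ)) (β : ℤ)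
      (ι : K →+* ℂ) (ℓ : ℕ) (d : KolyvaginHeegnerData Dt β ι ℓ),
      ℓ.Prime ∧ Zhang2014.IsKolyvaginPrime (((⟨0, -1, 1, -24, 54⟩ : WeierstrassCurve ℤ).map (Int.castRingHom ℚ)).conductorNorm ℤ) ((⟨0, -1, 1, -24, 54⟩ : WeierstrassCurve ℤ).map (Int.castRingHom ℚ)) K 7 ℓ ∧
        d.kolyvaginClass (p := 7) (by norm_num) 1 ≠ 0) ↔
    (∀ (D : ModularParametrizationData ((⟨0, -1, 1, -12872, -557532⟩ : WeierstrassCurve ℤ).map (Int.castRingHom ℚ))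
          (((⟨0, -1, 1, -12872, -557532⟩ : WeierstrassCurve ℤ).map (Int.castRingHom ℚ)).conductorNorm ℤ)),
        ¬ ((7 : ℕ) : ℤ) ∣ D.maninConstant →
        (∃ u : ℚ, ‖(u : ℚ_[7])‖ = 1 ∧
          ((⟨0, -1, 1, -12872, -557532⟩ : WeierstrassCurve ℤ).map (Int.castRingHom ℚ)).realPeriodRat = u * plusPeriod D.f) →
        ∃ ψ : (q : ℕ) → (ZMod q)ˣ →* Multiplicative (ZMod 7),
          (∀ q ∈ (617 : ℕ).primeFactors, Function.Surjective (ψ q)) ∧ kuriharaNumber D.f 7 617 ψ ≠ 0) := by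
  haveI := isElliptic_c997c1
  haveI := isGloballyMinimal_c997c1
  haveI iNZ : NeZero (((⟨0, -1, 1, -24, 54⟩ : WeierstrassCurve ℤ).map (Int.castRingHom ℚ)).conductorNorm ℤ) :=
    neZero_conductorNorm_of_isElliptic _
  haveI := minTwist23_isElliptic
  haveI := minTwist23_isGloballyMinimal
  haveI iNZT : NeZero (((⟨0, -1, 1, -12872, -557532⟩ : WeierstrassCurve ℤ).map (Int.castRingHom ℚ)).conductorNorm ℤ) :=
    neZero_conductorNorm_of_isElliptic _
  haveI iP := Fact.mk (by norm_num : Nat.Prime 7)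
  haveI : Fact (Nat.Prime 617) := ⟨by norm_num⟩
  haveI : NeZero (617 : ℕ) := ⟨by norm_num⟩
  constructor
  · intro hbit
    exact twistKuriharaClaim_617_of_natCard_selmerGroup_le hSak3 K hD
      ((exactRowZhang_7_neg23_rankFree h372 h84 K hK hD).mp hbit).2
  · intro hunit
    refine (kolyvaginPrime_iff_twistKuriharaBit_7_neg23 h372 h84 hKim hSak1 hSak2 hnf hMaz K hK hD hδE).mpr fun D hc hu ↦ ?_
    obtain ⟨ψ, hψ, hne⟩ := hunit D hc hu
    refine ⟨617, inferInstance, minTwist23_isCyclicKolyvaginLevel_7_617, ?_, ψ, hψ, hne⟩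
    rw [Nat.Prime.primeFactors (by norm_num), Finset.card_singleton]

/-- **AGREEMENT TEST for row `997c1` @ `(7, −23)`: unit at `239` ⟺ unit at `617`** (modulo the named facts and the E-side
claim): two decisive residues that DISAGREE contradict the print facts named (or the engine); DECISIVE-RESIDUES-v20 computed both
as units. Per curve; BSD is not proved by it. [cite: Sakamoto2022pSelmer, Lemma 4.4, Lemma 4.6 (1)] [cite: Kim2022StructureSelmer, Thm. 1.11] -/
theorem unit_239_iff_unit_617
    (h372 : GrossLMS1991.prop37_2_frobeniusCongruence)
    (h84 : Literature.NumberTheory.EllipticCurves.WZhang2014_lemma84_exists_minimal_kolyvaginClass_one_selmerCard)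
    (hKim : Kim2022_card_selmerGroup_le_pow_of_kuriharaNumber_ne_zero)
    (hSak1 : Sakamoto2022_card_selmerGroup_eq_pow_of_isDeltaMinimal)
    (hSak2 : Sakamoto2022_exists_cyclicLevel_kuriharaNumber_ne_zero)
    (hSak3 : Literature.NumberTheory.EllipticCurves.Sakamoto2022_kuriharaNumber_prime_ne_zero_of_localNondivisible)
    (hnf : exists_isNewformOf) (hMaz : mazur_not_dvd_maninConstant_of_odd)
    (K : Type) [Field K] [NumberField K] (hK : IsImaginaryQuadratic K) (hD : NumberField.discr K = -23)
    (hδE : haveI := isElliptic_c997c1; haveI := isGloballyMinimal_c997c1;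
      haveI : NeZero (((⟨0, -1, 1, -24, 54⟩ : WeierstrassCurve ℤ).map (Int.castRingHom ℚ)).conductorNorm ℤ) := neZero_conductorNorm_of_isElliptic _;
      haveI := Fact.mk (by norm_num : Nat.Prime 7);
      ∀ (D : ModularParametrizationData ((⟨0, -1, 1, -24, 54⟩ : WeierstrassCurve ℤ).map (Int.castRingHom ℚ)) (((⟨0, -1, 1, -24, 54⟩ : WeierstrassCurve ℤ).map (Int.castRingHom ℚ)).conductorNorm ℤ)), ¬ ((7 : ℕ) : ℤ) ∣ D.maninConstant →
        (∃ u : ℚ, ‖(u : ℚ_[7])‖ = 1 ∧ ((⟨0, -1, 1, -24, 54⟩ : WeierstrassCurve ℤ).map (Int.castRingHom ℚ)).realPeriodRat = u * plusPeriod D.f) →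
        ∃ ψ : (ℓ : ℕ) → (ZMod ℓ)ˣ →* Multiplicative (ZMod 7),
          (∀ ℓ ∈ (10277 : ℕ).primeFactors, Function.Surjective (ψ ℓ)) ∧ kuriharaNumber D.f 7 10277 ψ ≠ 0) :
    haveI := isElliptic_c997c1; haveI := isGloballyMinimal_c997c1;
      haveI : NeZero (((⟨0, -1, 1, -24, 54⟩ : WeierstrassCurve ℤ).map (Int.castRingHom ℚ)).conductorNorm ℤ) := neZero_conductorNorm_of_isElliptic _;
      haveI := Fact.mk (by norm_num : Nat.Prime 7);
    haveI := minTwist23_isElliptic; haveI := minTwist23_isGloballyMinimal;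
    haveI : NeZero (((⟨0, -1, 1, -12872, -557532⟩ : WeierstrassCurve ℤ).map (Int.castRingHom ℚ)).conductorNorm ℤ) := neZero_conductorNorm_of_isElliptic _;
    (∀ (D : ModularParametrizationData ((⟨0, -1, 1, -12872, -557532⟩ : WeierstrassCurve ℤ).map (Int.castRingHom ℚ))
          (((⟨0, -1, 1, -12872, -557532⟩ : WeierstrassCurve ℤ).map (Int.castRingHom ℚ)).conductorNorm ℤ)),
        ¬ ((7 : ℕ) : ℤ) ∣ D.maninConstant →
        (∃ u : ℚ, ‖(u : ℚ_[7])‖ = 1 ∧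
          ((⟨0, -1, 1, -12872, -557532⟩ : WeierstrassCurve ℤ).map (Int.castRingHom ℚ)).realPeriodRat = u * plusPeriod D.f) →
        ∃ ψ : (q : ℕ) → (ZMod q)ˣ →* Multiplicative (ZMod 7),
          (∀ q ∈ (239 : ℕ).primeFactors, Function.Surjective (ψ q)) ∧ kuriharaNumber D.f 7 239 ψ ≠ 0) ↔
    (∀ (D : ModularParametrizationData ((⟨0, -1, 1, -12872, -557532⟩ : WeierstrassCurve ℤ).map (Int.castRingHom ℚ))
          (((⟨0, -1, 1, -12872, -557532⟩ : WeierstrassCurve ℤ).map (Int.castRingHom ℚ)).conductorNorm ℤ)),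
        ¬ ((7 : ℕ) : ℤ) ∣ D.maninConstant →
        (∃ u : ℚ, ‖(u : ℚ_[7])‖ = 1 ∧
          ((⟨0, -1, 1, -12872, -557532⟩ : WeierstrassCurve ℤ).map (Int.castRingHom ℚ)).realPeriodRat = u * plusPeriod D.f) →
        ∃ ψ : (q : ℕ) → (ZMod q)ˣ →* Multiplicative (ZMod 7),
          (∀ q ∈ (617 : ℕ).primeFactors, Function.Surjective (ψ q)) ∧ kuriharaNumber D.f 7 617 ψ ≠ 0) := by
  haveI := isElliptic_c997c1
  haveI := isGloballyMinimal_c997c1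
  haveI iNZ : NeZero (((⟨0, -1, 1, -24, 54⟩ : WeierstrassCurve ℤ).map (Int.castRingHom ℚ)).conductorNorm ℤ) :=
    neZero_conductorNorm_of_isElliptic _
  haveI := minTwist23_isElliptic
  haveI := minTwist23_isGloballyMinimal
  haveI iNZT : NeZero (((⟨0, -1, 1, -12872, -557532⟩ : WeierstrassCurve ℤ).map (Int.castRingHom ℚ)).conductorNorm ℤ) :=
    neZero_conductorNorm_of_isElliptic _
  haveI iP := Fact.mk (by norm_num : Nat.Prime 7)
  rw [← twistKuriharaBit_iff_unit_239 h372 h84 hKim hSak1 hSak2 hSak3 hnf hMaz K hK hD hδE,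
    twistKuriharaBit_iff_unit_617 h372 h84 hKim hSak1 hSak2 hSak3 hnf hMaz K hK hD hδE]

end C997c1

end Summit.BirchSwinnertonDyer.BirchSwinnertonDyer.Theorems.KolyvaginDepthDoor

end
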